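import Mathlib
import HarnessLib
import Summits.NavierStokesRegularity.NavierStokesRegularity.Theorems.CompletionRelayChainRelayFrontStepWakeShell

/-!
# `CompletionRelayChain` — crux `RelayFrontStep` (24850), LINE `window_v2`, stub `stub_ignition` (Phase II):
  bond-flux algebra for the NEAR-WAKE shell energies (blueprint §2)

The relay rows conserve each shell's energy up to the bond fluxes
`Φ_k = Λ_k u_k (u_k x_{k+1} + r_k u_{k+1}/32)` (tree `shell_power_eq`: `Σᵢ quadTerm·S = Φ_{k−1} − Φ_k`).
This file bounds a flux pointwise along a pseudo-flow from SHELL-ENERGY caps: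
* `flux_sq_le`, `flux_sq_le_energy`: `Φ_k² ≤ Λ_k²·u_k²(u_k²+r_k²)(x_{k+1}²+u_{k+1}²) ≤ 8Λ_k² E_k² E_{k+1}`
  (Lagrange's identity), and `sq_mul_le_of_sum_le`: `E² E' ≤ 4W³/27` when `E + E' ≤ W` (AM–GM) — the
  JOINT budget used for the flux from old shell `−2` into old shell `−1`;
* `clock_sq`: `Λ_k² = 2^{5k}`; `flux_abs_le`: `|Φ_k| ≤ C` whenever `8·2^{5k}·e²·e' ≤ C²`;
* sign-split bounds `neg_flux_le` / `flux_le_pos` (the back-flow `−Φ_k ≤ Λ_k(U²·x⁻ + E_k·|u_{k+1}|/32)` needs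
  only a FLOOR of the carrier above) and `neg_flux_front_le` (`−Φ₀ ≤ E₀|u₁|/32` while `x₁ ≥ 0`);
* `shell_sq_le`, `two_modes_sq_le`: amplitude squares under the shell energy.

No definitions. HONEST FRAMING: elementary algebra on the MODEL lattice (Tao 2016 §4 vocabulary); helper
for the crux, no stub credit; nothing here is a statement about the Navier–Stokes equations.
-/

noncomputable section

-- the summit-side namespace repeats a component by design (D-0017)
set_option linter.dupNamespace false

open Set MeasureTheory intervalIntegral Literature.Analysis.FluidPDE Literature.Analysis.FluidPDE.TaoCascade
open Summit.NavierStokesRegularity.NavierStokesRegularity.Theorems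
open Summit.NavierStokesRegularity.NavierStokesRegularity.Theorems.RelayFrontStep

namespace Summit.NavierStokesRegularity.NavierStokesRegularity.Cruxes.RelayFrontStep.Window2

/-! ### Algebra -/

/-- Lagrange: `(Λu(u·xp + r·up/32))² ≤ Λ²·u²·(u²+r²)·(xp²+up²)`. [folklore] -/
theorem flux_sq_le (Λ u r xp up : ℝ) :
    (Λ * u * (u * xp + 1 / 32 * r * up)) ^ 2 ≤ Λ ^ 2 * (u ^ 2 * ((u ^ 2 + r ^ 2) * (xp ^ 2 + up ^ 2))) := by
  have h1 : (u * xp + 1 / 32 * r * up) ^ 2 ≤ (u ^ 2 + r ^ 2) * (xp ^ 2 + up ^ 2) := by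
    nlinarith [sq_nonneg (u * up - r * xp), sq_nonneg (u * up + r * xp), sq_nonneg (r * up),
      sq_nonneg (u * up), sq_nonneg (r * xp)]
  calc (Λ * u * (u * xp + 1 / 32 * r * up)) ^ 2 = Λ ^ 2 * (u ^ 2 * (u * xp + 1 / 32 * r * up) ^ 2) := by ring
    _ ≤ Λ ^ 2 * (u ^ 2 * ((u ^ 2 + r ^ 2) * (xp ^ 2 + up ^ 2))) := by gcongr

/-- Energy form: `u² + r² ≤ 2e`, `xp² + up² ≤ 2e'` ⇒ `Φ² ≤ 8Λ²e²e'`. [folklore] -/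
theorem flux_sq_le_energy {Λ u r xp up e e' : ℝ} (h1 : u ^ 2 + r ^ 2 ≤ 2 * e) (h2 : xp ^ 2 + up ^ 2 ≤ 2 * e') :
    (Λ * u * (u * xp + 1 / 32 * r * up)) ^ 2 ≤ 8 * Λ ^ 2 * e ^ 2 * e' := by
  have hu : u ^ 2 ≤ 2 * e := by nlinarith [sq_nonneg r]
  have he : 0 ≤ 2 * e := (sq_nonneg u).trans hu
  have hA : 0 ≤ u ^ 2 + r ^ 2 := by positivity
  have hB : 0 ≤ xp ^ 2 + up ^ 2 := by positivity
  have h3 : (u ^ 2 + r ^ 2) * (xp ^ 2 + up ^ 2) ≤ (2 * e) * (2 * e') := mul_le_mul h1 h2 hB he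
  have h4 : u ^ 2 * ((u ^ 2 + r ^ 2) * (xp ^ 2 + up ^ 2)) ≤ (2 * e) * ((2 * e) * (2 * e')) :=
    mul_le_mul hu h3 (mul_nonneg hA hB) he
  calc (Λ * u * (u * xp + 1 / 32 * r * up)) ^ 2 ≤ Λ ^ 2 * (u ^ 2 * ((u ^ 2 + r ^ 2) * (xp ^ 2 + up ^ 2))) :=
        flux_sq_le Λ u r xp up
    _ ≤ Λ ^ 2 * ((2 * e) * ((2 * e) * (2 * e'))) := by gcongr
    _ = 8 * Λ ^ 2 * e ^ 2 * e' := by ring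

/-- AM–GM: `0 ≤ e, e'`, `e + e' ≤ W` ⇒ `e²e' ≤ 4W³/27` (`4(e+e')³ − 27e²e' = (e − 2e')²(4e + e')`). [folklore] -/
theorem sq_mul_le_of_sum_le {e e' W : ℝ} (he : 0 ≤ e) (he' : 0 ≤ e') (hW : e + e' ≤ W) :
    e ^ 2 * e' ≤ 4 * W ^ 3 / 27 := by
  have h1 : 27 * (e ^ 2 * e') ≤ 4 * (e + e') ^ 3 := by
    have h := mul_nonneg (sq_nonneg (e - 2 * e')) (by linarith : 0 ≤ 4 * e + e')
    nlinarith [h]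
  have h2 : (e + e') ^ 3 ≤ W ^ 3 := pow_le_pow_left₀ (by linarith) hW 3
  linarith

/-- The squared clock of shell `k`: `((1+1)^{5k/2})² = 2^{5k}`. [this file] -/
theorem clock_sq (k : ℤ) : ((1 + 1 : ℝ) ^ ((5 : ℝ) * (k : ℝ) / 2)) ^ 2 = (2 : ℝ) ^ (5 * k) := by
  rw [show (1 + 1 : ℝ) = 2 by norm_num, ← Real.rpow_natCast, ← Real.rpow_mul (by norm_num)]
  rw [show (5 : ℝ) * (k : ℝ) / 2 * ((2 : ℕ) : ℝ) = ((5 * k : ℤ) : ℝ) by push_cast; ring]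
  exact Real.rpow_intCast 2 (5 * k)

/-! ### Pointwise bounds along a pseudo-flow -/

variable {τ κ₁ κ₂ : ℝ} {α : Fin 4 → Fin 4 → Fin 4 → ℤ × ℤ × ℤ → ℝ}
  {S₀ F₀ B₀ : Fin 4 → ℤ → ℝ} {S F : Fin 4 → ℤ → ℝ → ℝ}

/-- One amplitude square under the shell energy: `S i k² ≤ 2Σᵢ F i k`. [this file] -/
theorem shell_sq_le (h : PseudoFlowOn τ 1 α κ₁ κ₂ S₀ F₀ B₀ S F) (i : Fin 4) (k : ℤ) {s : ℝ}
    (hs : s ∈ Icc 0 τ) : S i k s ^ 2 ≤ 2 * ∑ j, F j k s := by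
  have h1 := h.defect_lower i k s hs
  have h2 : F i k s ≤ ∑ j, F j k s :=
    Finset.single_le_sum (f := fun j => F j k s) (fun j _ => h.nonneg_F j k s hs) (Finset.mem_univ i)
  linarith

/-- Trigger and relay squares together under the shell energy: `S 1 k² + S 2 k² ≤ 2Σᵢ F i k`. [this file] -/
theorem two_modes_sq_le (h : PseudoFlowOn τ 1 α κ₁ κ₂ S₀ F₀ B₀ S F) (k : ℤ) {s : ℝ} (hs : s ∈ Icc 0 τ) :
    S 1 k s ^ 2 + S 2 k s ^ 2 ≤ 2 * ∑ j, F j k s := by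
  have h1 := h.defect_lower 1 k s hs
  have h2 := h.defect_lower 2 k s hs
  have h0 := h.nonneg_F 0 k s hs
  have h3 := h.nonneg_F 3 k s hs
  rw [Fin.sum_univ_four]
  linarith

/-- Carrier and trigger squares together under the shell energy: `S 0 k² + S 1 k² ≤ 2Σᵢ F i k`. [this file] -/
theorem carrier_trigger_sq_le (h : PseudoFlowOn τ 1 α κ₁ κ₂ S₀ F₀ B₀ S F) (k : ℤ) {s : ℝ} (hs : s ∈ Icc 0 τ) :
    S 0 k s ^ 2 + S 1 k s ^ 2 ≤ 2 * ∑ j, F j k s := by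
  have h1 := h.defect_lower 0 k s hs
  have h2 := h.defect_lower 1 k s hs
  have h0 := h.nonneg_F 2 k s hs
  have h3 := h.nonneg_F 3 k s hs
  rw [Fin.sum_univ_four]
  linarith

/-- Product of trigger and relay under the shell energy: `|S 1 k · S 2 k| ≤ Σᵢ F i k`. [this file] -/
theorem trigger_relay_abs_le (h : PseudoFlowOn τ 1 α κ₁ κ₂ S₀ F₀ B₀ S F) (k : ℤ) {s : ℝ} (hs : s ∈ Icc 0 τ) :
    |S 1 k s * S 2 k s| ≤ ∑ j, F j k s := by
  have h1 := two_modes_sq_le h k hs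
  rw [abs_le]
  constructor
  · nlinarith [sq_nonneg (S 1 k s + S 2 k s)]
  · nlinarith [sq_nonneg (S 1 k s - S 2 k s)]

/-- **FLUX BOUND FROM SHELL ENERGIES**: if `Σᵢ F i k ≤ e`, `Σᵢ F i (k+1) ≤ e'` and `8·2^{5k}·e²·e' ≤ C²`
(`0 ≤ C`), then `|Φ_k| ≤ C`. [cite: Tao2016AveragedNS, §4 Lemma 4.1 (4.10)] -/
theorem flux_abs_le (h : PseudoFlowOn τ 1 α κ₁ κ₂ S₀ F₀ B₀ S F) {k : ℤ} {s : ℝ} (hs : s ∈ Icc 0 τ)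
    {e e' C : ℝ} (he : ∑ i, F i k s ≤ e) (he' : ∑ i, F i (k + 1) s ≤ e') (hC : 0 ≤ C)
    (hCC : 8 * (2 : ℝ) ^ (5 * k) * e ^ 2 * e' ≤ C ^ 2) :
    |(1 + 1 : ℝ) ^ ((5 : ℝ) * (k : ℝ) / 2) * S 1 k s *
        (S 1 k s * S 0 (k + 1) s + (1 / 32 : ℝ) * S 2 k s * S 1 (k + 1) s)| ≤ C := by
  refine abs_le_of_sq_le_sq ?_ hC
  have h1 : S 1 k s ^ 2 + S 2 k s ^ 2 ≤ 2 * e := (two_modes_sq_le h k hs).trans (by linarith)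
  have h2 : S 0 (k + 1) s ^ 2 + S 1 (k + 1) s ^ 2 ≤ 2 * e' :=
    (carrier_trigger_sq_le h (k + 1) hs).trans (by linarith)
  have h3 := flux_sq_le_energy (Λ := (1 + 1 : ℝ) ^ ((5 : ℝ) * (k : ℝ) / 2)) h1 h2
  rw [clock_sq] at h3
  linarith

/-- **BACK-FLOW BOUND** (sign split): with `x_{k+1} ≥ −Xm` (`Xm ≥ 0`), `|u_{k+1}| ≤ U0`, `u_k² ≤ U1sq`,
`Σᵢ F i k ≤ e`: `−Φ_k ≤ Λ_k(U1sq·Xm + e·U0/32)`. [this file] -/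
theorem neg_flux_le (h : PseudoFlowOn τ 1 α κ₁ κ₂ S₀ F₀ B₀ S F) {k : ℤ} {s : ℝ} (hs : s ∈ Icc 0 τ)
    {Xm U0 U1sq e : ℝ} (hXm : 0 ≤ Xm) (hx : -Xm ≤ S 0 (k + 1) s) (hu0 : |S 1 (k + 1) s| ≤ U0)
    (hu1 : S 1 k s ^ 2 ≤ U1sq) (he : ∑ i, F i k s ≤ e) :
    -((1 + 1 : ℝ) ^ ((5 : ℝ) * (k : ℝ) / 2) * S 1 k s *
        (S 1 k s * S 0 (k + 1) s + (1 / 32 : ℝ) * S 2 k s * S 1 (k + 1) s)) ≤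
      (1 + 1 : ℝ) ^ ((5 : ℝ) * (k : ℝ) / 2) * (U1sq * Xm + e * U0 / 32) := by
  set Λ : ℝ := (1 + 1 : ℝ) ^ ((5 : ℝ) * (k : ℝ) / 2) with hΛ
  have hΛ0 : 0 ≤ Λ := (Real.rpow_pos_of_pos (by norm_num) _).le
  have hU0 : 0 ≤ U0 := (abs_nonneg _).trans hu0
  have hprod := trigger_relay_abs_le h k hs
  -- carrier part: −u² x ≤ u² Xm ≤ U1sq Xm
  have h1 : -(S 1 k s ^ 2 * S 0 (k + 1) s) ≤ U1sq * Xm := by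
    have ha : -(S 1 k s ^ 2 * S 0 (k + 1) s) ≤ S 1 k s ^ 2 * Xm := by nlinarith [sq_nonneg (S 1 k s)]
    exact ha.trans (mul_le_mul_of_nonneg_right hu1 hXm)
  -- cross part: −u r up/32 ≤ |u r|·|up|/32 ≤ e U0/32
  have h2 : -(S 1 k s * S 2 k s * S 1 (k + 1) s) ≤ e * U0 := by
    have ha : -(S 1 k s * S 2 k s * S 1 (k + 1) s) ≤ |S 1 k s * S 2 k s| * |S 1 (k + 1) s| := by
      rw [← abs_mul]; exact neg_le_abs _
    exact ha.trans (mul_le_mul (hprod.trans he) hu0 (abs_nonneg _) ((abs_nonneg _).trans (hprod.trans he)))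
  have h3 : -(S 1 k s * (S 1 k s * S 0 (k + 1) s + (1 / 32 : ℝ) * S 2 k s * S 1 (k + 1) s)) ≤
      U1sq * Xm + e * U0 / 32 := by
    have e1 : -(S 1 k s * (S 1 k s * S 0 (k + 1) s + (1 / 32 : ℝ) * S 2 k s * S 1 (k + 1) s)) =
        -(S 1 k s ^ 2 * S 0 (k + 1) s) + (1 / 32) * -(S 1 k s * S 2 k s * S 1 (k + 1) s) := by ring
    rw [e1]; linarith
  calc -(Λ * S 1 k s * (S 1 k s * S 0 (k + 1) s + (1 / 32 : ℝ) * S 2 k s * S 1 (k + 1) s))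
      = Λ * -(S 1 k s * (S 1 k s * S 0 (k + 1) s + (1 / 32 : ℝ) * S 2 k s * S 1 (k + 1) s)) := by ring
    _ ≤ Λ * (U1sq * Xm + e * U0 / 32) := mul_le_mul_of_nonneg_left h3 hΛ0

/-- **FORWARD-FLOW BOUND** (sign split): with `x_{k+1} ≤ Xp` (`Xp ≥ 0`), `|u_{k+1}| ≤ U0`, `u_k² ≤ U1sq`,
`Σᵢ F i k ≤ e`: `Φ_k ≤ Λ_k(U1sq·Xp + e·U0/32)`. [this file] -/
theorem flux_le_pos (h : PseudoFlowOn τ 1 α κ₁ κ₂ S₀ F₀ B₀ S F) {k : ℤ} {s : ℝ} (hs : s ∈ Icc 0 τ)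
    {Xp U0 U1sq e : ℝ} (hXp : 0 ≤ Xp) (hx : S 0 (k + 1) s ≤ Xp) (hu0 : |S 1 (k + 1) s| ≤ U0)
    (hu1 : S 1 k s ^ 2 ≤ U1sq) (he : ∑ i, F i k s ≤ e) :
    (1 + 1 : ℝ) ^ ((5 : ℝ) * (k : ℝ) / 2) * S 1 k s *
        (S 1 k s * S 0 (k + 1) s + (1 / 32 : ℝ) * S 2 k s * S 1 (k + 1) s) ≤
      (1 + 1 : ℝ) ^ ((5 : ℝ) * (k : ℝ) / 2) * (U1sq * Xp + e * U0 / 32) := by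
  set Λ : ℝ := (1 + 1 : ℝ) ^ ((5 : ℝ) * (k : ℝ) / 2) with hΛ
  have hΛ0 : 0 ≤ Λ := (Real.rpow_pos_of_pos (by norm_num) _).le
  have hU0 : 0 ≤ U0 := (abs_nonneg _).trans hu0
  have hprod := trigger_relay_abs_le h k hs
  have h1 : S 1 k s ^ 2 * S 0 (k + 1) s ≤ U1sq * Xp := by
    have ha : S 1 k s ^ 2 * S 0 (k + 1) s ≤ S 1 k s ^ 2 * Xp :=
      mul_le_mul_of_nonneg_left hx (sq_nonneg _)
    exact ha.trans (mul_le_mul_of_nonneg_right hu1 hXp)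
  have h2 : S 1 k s * S 2 k s * S 1 (k + 1) s ≤ e * U0 := by
    have ha : S 1 k s * S 2 k s * S 1 (k + 1) s ≤ |S 1 k s * S 2 k s| * |S 1 (k + 1) s| := by
      rw [← abs_mul]; exact le_abs_self _
    exact ha.trans (mul_le_mul (hprod.trans he) hu0 (abs_nonneg _) ((abs_nonneg _).trans (hprod.trans he)))
  have h3 : S 1 k s * (S 1 k s * S 0 (k + 1) s + (1 / 32 : ℝ) * S 2 k s * S 1 (k + 1) s) ≤
      U1sq * Xp + e * U0 / 32 := by
    have e1 : S 1 k s * (S 1 k s * S 0 (k + 1) s + (1 / 32 : ℝ) * S 2 k s * S 1 (k + 1) s) =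
        S 1 k s ^ 2 * S 0 (k + 1) s + (1 / 32) * (S 1 k s * S 2 k s * S 1 (k + 1) s) := by ring
    rw [e1]; linarith
  calc Λ * S 1 k s * (S 1 k s * S 0 (k + 1) s + (1 / 32 : ℝ) * S 2 k s * S 1 (k + 1) s)
      = Λ * (S 1 k s * (S 1 k s * S 0 (k + 1) s + (1 / 32 : ℝ) * S 2 k s * S 1 (k + 1) s)) := by ring
    _ ≤ Λ * (U1sq * Xp + e * U0 / 32) := mul_le_mul_of_nonneg_left h3 hΛ0

/-- **FRONT OUT-FLOW SIGN**: while the front carrier `x₁ ≥ 0`, the flux `Φ₀ = u₀(u₀x₁ + r₀u₁/32)` out of old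
shell `0` satisfies `−Φ₀ ≤ Σᵢ F i 0 · |u₁|/32`. [this file] -/
theorem neg_flux_front_le (h : PseudoFlowOn τ 1 α κ₁ κ₂ S₀ F₀ B₀ S F) {s : ℝ} (hs : s ∈ Icc 0 τ)
    {U1 e : ℝ} (hx1 : 0 ≤ S 0 1 s) (hu1 : |S 1 1 s| ≤ U1) (he : ∑ i, F i 0 s ≤ e) :
    -((1 + 1 : ℝ) ^ ((5 : ℝ) * ((0 : ℤ) : ℝ) / 2) * S 1 0 s *
        (S 1 0 s * S 0 (0 + 1) s + (1 / 32 : ℝ) * S 2 0 s * S 1 (0 + 1) s)) ≤ e * U1 / 32 := by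
  have hΛ : (1 + 1 : ℝ) ^ ((5 : ℝ) * ((0 : ℤ) : ℝ) / 2) = 1 := by norm_num
  rw [hΛ, one_mul, show (0 : ℤ) + 1 = 1 by norm_num]
  have hU1 : 0 ≤ U1 := (abs_nonneg _).trans hu1
  have hprod := trigger_relay_abs_le h 0 hs
  have h1 : 0 ≤ S 1 0 s ^ 2 * S 0 1 s := mul_nonneg (sq_nonneg _) hx1
  have h2 : -(S 1 0 s * S 2 0 s * S 1 1 s) ≤ e * U1 := by
    have ha : -(S 1 0 s * S 2 0 s * S 1 1 s) ≤ |S 1 0 s * S 2 0 s| * |S 1 1 s| := by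
      rw [← abs_mul]; exact neg_le_abs _
    exact ha.trans (mul_le_mul (hprod.trans he) hu1 (abs_nonneg _) ((abs_nonneg _).trans (hprod.trans he)))
  have e1 : -(S 1 0 s * (S 1 0 s * S 0 1 s + (1 / 32 : ℝ) * S 2 0 s * S 1 1 s)) =
      -(S 1 0 s ^ 2 * S 0 1 s) + (1 / 32) * -(S 1 0 s * S 2 0 s * S 1 1 s) := by ring
  rw [e1]; linarith

end Summit.NavierStokesRegularity.NavierStokesRegularity.Cruxes.RelayFrontStep.Window2
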